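import Summits.QuantumFields.BalabanUV.T4Continuum.Support.NE7EnergyRateWGeneric
import Summits.QuantumFields.BalabanUV.T4Continuum.Support.NE7EnergyClassPoincareGeneric
import HarnessLib

/-!
# NE7EnergyRateWAnyGroup — NODE NE3's RE-TYPED ROOT T-E_w♯ AT `d = 4`, `L = 2` FOR EVERY UNITARY GAUGE GROUP `U(n)`, NO DISPLAYED HYPOTHESIS: gen 105's
# `NE7EnergyRateWGeneric.ne3EnergyRateWSup_of_classPoincare` (T-E_w♯ modulo the class slice-Poincaré inequality of `𝒯_E`) with that inequality DISCHARGED for every `n` by this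
# generation's `NE7EnergyClassPoincareGeneric.classSlicePoincare_energyBlockLandau_generic_d4_L2` — the SU(2)∕SU(3) files `NE7EnergyRateWSU2∕SU3` become instances

Cell `pub-balaban`, rung (B)+1 sub-cell t4, lineage `b2b-balaban-t4-ne7-p1`, generation 109 (CRUX PROVER NE7 #1 = OWNER of BINDER row NE7).  Memo
`t4/b2b-balaban-t4-ne7-p1-g109/ROAD-G109.md` §2.
WHAT ([folklore]; 0 def, 0 sorry).  **`ne3EnergyRateWSup_anyGroup`**: for every nonempty finite index type `n` (gauge group `U(n)`):
`∃ ε₀ > 0, ∀ 0 < ε ≤ ε₀, ∀ b g, 0 ≤ b → b + 10⁸b² ≤ ε → 0 < g → ∃ C s ≥ 0, ∀ N ≥ 1, ∀ dom, NE3EnergyRateWSup 4 (sfClass 4 2 N ε) 2 N b g C s dom` — for every level and every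
minimiser pair of the `U(n)` small-field class with `Regular` data, the η-rate of the block-averaged finer minimiser against the coarser one in the weighted energy norm, plus the sup
letter.  (Non-vacuity of such pairs — the (8)∃∕(8)∀∕(H∀)ᴱ chain of gens 93–105 — is in the tree at `card n = 2` only; its port to every `n` and every `L` is the PORT MAP of ROAD-G109 §3.)
HONEST FRAMING (page 1): composition of landed kernel theorems; nothing of Bałaban's asserted as an axiom; `n : Type`; `L = 2`, `d = 4`; constants existential; NOT NE3∕NE7 as spine nodes;
spine 0∕9; finite T⁴ rung (B)+1 — NOT infinite volume, NOT mass gap, NOT BetaPertH, NOT Clay (continuum YM on T⁴ ⇐ BetaPertH ∧ nine spine estimates).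
-/

set_option autoImplicit false

namespace Summit.QuantumFields.BalabanUV.T4Continuum.NE7EnergyRateWAnyGroup

open Literature.MathematicalPhysics.QuantumFieldTheory.Balaban1983to89
open B7Prop1Explicit B7Prop2Explicit
open MinimalActionRate (sfClass)
open NE3EnergyWeightedSupShape (NE3EnergyRateWSup)
open NE7EnergyRateWGeneric (ne3EnergyRateWSup_of_classPoincare)
open NE7EnergyClassPoincareGeneric (classSlicePoincare_energyBlockLandau_generic_d4_L2)

noncomputable section

variable {n : Type} [Fintype n] [DecidableEq n]

/-- **T-E_w♯ FOR EVERY UNITARY GAUGE GROUP `U(n)`, `d = 4`, `L = 2`, NO DISPLAYED HYPOTHESIS** (statement in the file header). [folklore] -/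
theorem ne3EnergyRateWSup_anyGroup [Nonempty n] :
    ∃ ε₀ : ℝ, 0 < ε₀ ∧ ∀ ε : ℝ, 0 < ε → ε ≤ ε₀ → ∀ b g : ℝ, 0 ≤ b → b + 10 ^ 8 * b ^ 2 ≤ ε → 0 < g →
      ∃ C s : ℝ, 0 ≤ C ∧ 0 ≤ s ∧ ∀ (N : ℕ) [NeZero N] (dom : Set (Site 4 → Fin 4 → (Matrix n n ℂ)ˣ)),
        NE3EnergyRateWSup 4 (sfClass 4 2 N ε) 2 N b g C s dom := by
  obtain ⟨ε₁, CE, hε₁, hε₁11, hCE, hP⟩ := classSlicePoincare_energyBlockLandau_generic_d4_L2 (n := n)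
  exact ne3EnergyRateWSup_of_classPoincare (n := n) hCE hε₁ hε₁11 hP

end

end Summit.QuantumFields.BalabanUV.T4Continuum.NE7EnergyRateWAnyGroup
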